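import Literature.AlgebraicGeometry.Motives.GrothendieckComplexFieldPoints
import Literature.AlgebraicGeometry.Motives.CartierDivisorFibreSections
import Literature.AlgebraicGeometry.Limits.SubalgebraDiagram
import HarnessLib

/-!
# Sections over `X_L = X ×_K Spec L` along a field-valued point `Spec L → T`: affine base change
# of functions and of `𝒪(D)` (Görtz–Wedhorn II, proof of Prop. 22.90; Görtz–Wedhorn I, (11.16))

`Motives/FibreBaseChange` and `Motives/CartierDivisorFibreSections` prove, for the fibre `X_t` of
`pr_T : X ×_K T → T` over `t ∈ T`, the affine base change of functions
`κ(t) ⊗_{Γ(V, 𝒪_T)} Γ(W, 𝒪_{X ×_K T}) ⥲ Γ(W_t, 𝒪_{X_t})` and of the sections of `𝒪(D)` for a Cartier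
divisor `D`. This file is the same mathematics for an arbitrary **field-valued point**
`τ : Spec L → T` over `K` (a field `L`, `π : Spec L → Spec K`, a `K`-morphism `τ : Over.mk π ⟶ T`), which
is what Görtz–Wedhorn II, Cor. 23.137 ("isomorphisms, functorial in the `A`-algebra `B`") with `B = L`
a field, i.e. the named fact `cechComplex_h0_fieldPoint` of `Motives/GrothendieckComplexFieldPointsCech`,
needs; the residue field is the case `π = (Spec κ(t) → T → Spec K)`, `τ = residuePtι T t`:

* `isPullback_whiskerLeft_mk` — the square `X_L → X ×_K T → T ← Spec L ← X_L` is cartesian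
  (`X_L = (X ⊗ Over.mk π).left`, the maps being `(X ◁ τ).left` and
  `fieldPointStr X π = pullback.snd X.hom π`; this is `Limits.SubalgApprox.isPullback_whiskerLeft_left`);
* `appLE_ΓSpecIso_eq_evalAtFieldPoint` — pulling back functions along `τ` and identifying
  `Γ(Spec L, 𝒪) = L` is **evaluation at `τ`** (`evalAtFieldPoint` of
  `Motives/GrothendieckComplexFieldPoints`; Mathlib `Scheme.germ_stalkClosedPointTo`);
* `isPushout_sections_fieldPoint`, `algebraIsPushout_fieldPoint`, `fieldPointSectionsEquiv` (+ `_tmul`)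
  — for affine `V ∋ τ(*)` and affine `W ⊆ pr_T⁻¹V`, **`L ⊗_{Γ(V, 𝒪_T)} Γ(W, 𝒪_{X ×_K T}) ⥲ Γ(W_L, 𝒪_{X_L})`**,
  `W_L = ((X ◁ τ).left)⁻¹W`, `Γ(V, 𝒪_T)` acting on `L` by evaluation at `τ` (Görtz–Wedhorn II, proof of
  Prop. 22.90, p. 388: "`𝓕(V) ⊗_A A' = 𝓕(u'⁻¹(V), 𝓕')` for every open affine subscheme `V ⊆ X`", for
  `𝓕 = 𝒪` and the base change `Spec L → V`; Mathlib `isIso_pushoutSection_of_isAffineOpen`);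
* `CartierDivisor.fieldPointSectionsOnEquiv` (+ `coe_…_tmul`, `subsingleton_…`) — for `X_L` integral and
  `W ⊆ pr_T⁻¹V ∩ U_c` affine containing `y_L = (X ◁ τ)(η_{X_L})`:
  **`L ⊗_{Γ(V, 𝒪_T)} Γ(W, 𝒪(D)) ⥲ Γ(W_L, 𝒪_{X_L}(D_τ))`**, `D_τ = classPullback D (X ◁ τ).left`,
  `c ⊗ s ↦ c · ι^♯(f_{i₀} s)` (`CartierDivisor.fibreFn`; Görtz–Wedhorn I, (11.16): `f^*𝒪(D) ≅ 𝒪(f^*D)`),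
  and `L ⊗ Γ(W, 𝒪(D)) = 0` when `y_L ∉ W` (`W_L = ∅`).

Everything is proved; the proofs are those of the two fibre files with `Spec κ(t)` replaced by `Spec L`
(those files are left untouched; their statements are the special case `τ = residuePtι T t`). Mathlib
searched (pin): `isIso_pushoutSection_of_isAffineOpen`, `isIso_pushoutSection_iff`,
`Scheme.germ_stalkClosedPointTo`, `Scheme.preimage_eq_top_of_closedPoint_mem`,
`CommRingCat.isPushout_iff_isPushout`, `Algebra.IsPushout.equiv(_tmul)`, `LinearEquiv.baseChange` (used).
In this tree (used): `evalAtFieldPoint`, `fibreOverField`, `prSecAlgebra`, `CartierDivisor.sectionsOnEquiv`,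
`CartierDivisor.fibreFn`, `CartierDivisor.classPullbackChart`, `RatFn.ofSection_appLE`,
`Limits.SubalgApprox.isPullback_whiskerLeft_left`.

## References

* U. Görtz, T. Wedhorn, *Algebraic Geometry II: Cohomology of Schemes*, Springer Spektrum (2023),
  doi:10.1007/978-3-658-43031-3: Prop. 22.90 and its proof, pp. 387–388; Cor. 23.137, p. 480;
  (23.28.5), p. 482 (read via the held copy). [GortzWedhorn2023]
* U. Görtz, T. Wedhorn, *Algebraic Geometry I: Schemes*, 2nd ed., Springer Spektrum (2020),
  doi:10.1007/978-3-658-30733-2: (11.9), p. 374; (11.16), Def. 11.49, p. 392; Prop. 12.6, p. 405.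
  [GortzWedhorn2020]
-/

universe u

open CategoryTheory CategoryTheory.Limits AlgebraicGeometry MonoidalCategory TopologicalSpace TensorProduct
open CartesianMonoidalCategory Literature.AlgebraicGeometry.Motives.RatFn

noncomputable section

namespace Literature.AlgebraicGeometry.Motives

/-! ### Evaluation at a field-valued point as pull-back of functions -/

section Eval

variable {L : Type u} [Field L] {S : Scheme.{u}}

/-- **Evaluation at `τ : Spec L → S` is `Γ(V, 𝒪_S) → Γ(Spec L, 𝒪) ≅ L`**: pulling back a function on
`V ∋ τ(*)` along `τ` and identifying `Γ(Spec L, 𝒪) = L` gives `evalAtFieldPoint τ V`. [folklore] -/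
theorem appLE_ΓSpecIso_eq_evalAtFieldPoint (τ : Spec (.of L) ⟶ S) (V : S.Opens)
    (h : τ (IsLocalRing.closedPoint L) ∈ V) :
    τ.appLE V ⊤ (Scheme.preimage_eq_top_of_closedPoint_mem τ h).ge ≫
        (Scheme.ΓSpecIso (.of L)).hom =
      CommRingCat.ofHom (evalAtFieldPoint τ V h) := by
  change _ = S.presheaf.germ V _ h ≫ Scheme.stalkClosedPointTo τ
  rw [Scheme.germ_stalkClosedPointTo τ V h, Iso.trans_hom, Functor.mapIso_hom, ← Category.assoc]
  congr 1

end Eval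

/-! ### The base-change square of a field-valued point -/

section Square

variable {K : Type u} [Field K] (X T : SchemeOver K) {L : Type u} [Field L]
  (π : Spec (.of L) ⟶ Spec (.of K)) (τ : Over.mk π ⟶ T)

/-- The structure morphism `X_L → Spec L` of `fibreOverField X π`, with source typed as
`(X ⊗ Over.mk π).left` (an `abbrev`; cf. `fibreStr` of `Motives/FibreBaseChange`). [folklore] -/
abbrev fieldPointStr : (X ⊗ Over.mk π).left ⟶ Spec (.of L) := pullback.snd X.hom π

/-- **`X_L = (X ×_K T) ×_T Spec L`**: the square `X_L → X ×_K T → T ← Spec L ← X_L` (maps `(X ◁ τ).left`,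
`pr_T = (snd X T).left`, `τ`, `fieldPointStr X π`) is cartesian (Görtz–Wedhorn I, Prop. 4.16;
`Limits.SubalgApprox.isPullback_whiskerLeft_left`). [folklore] -/
theorem isPullback_whiskerLeft_mk :
    IsPullback (X ◁ τ).left (fieldPointStr X π) (snd X T).left τ.left :=
  Limits.SubalgApprox.isPullback_whiskerLeft_left X τ

variable {T π} in
/-- `Spec L → T` maps into every open containing `τ(*)`. [folklore] -/
theorem top_le_preimage_fieldPoint {V : T.left.Opens} (hτ : τ.left (IsLocalRing.closedPoint L) ∈ V) :
    (⊤ : (Spec (.of L)).Opens) ≤ τ.left ⁻¹ᵁ V := (Scheme.preimage_eq_top_of_closedPoint_mem τ.left hτ).ge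

variable {X T π τ}

/-- **The sections over `W_L ⊆ X_L` form the pushout `Γ(W, 𝒪) ⊗_{Γ(V, 𝒪_T)} L`** for affine `W ⊆ pr_T⁻¹V`,
`V ∋ τ(*)` affine, `Γ(V, 𝒪_T) → L` the evaluation at `τ`: the square of rings
`Γ(V, 𝒪_T) → Γ(W, 𝒪_{X ×_K T}) → Γ(W_L, 𝒪_{X_L}) ← L ← Γ(V, 𝒪_T)` is cocartesian (Mathlib
`isIso_pushoutSection_of_isAffineOpen` for the cartesian square `isPullback_whiskerLeft_mk`, `Γ(Spec L, 𝒪) ≅ L`;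
Görtz–Wedhorn II, proof of Prop. 22.90). [cite: GortzWedhorn2023, Prop. 22.90, proof (p. 388)] -/
theorem isPushout_sections_fieldPoint {V : T.left.Opens} (hτ : τ.left (IsLocalRing.closedPoint L) ∈ V)
    {W : (X ⊗ T).left.Opens} (hWV : W ≤ (snd X T).left ⁻¹ᵁ V) (hV : IsAffineOpen V)
    (hW : IsAffineOpen W) :
    IsPushout ((snd X T).left.appLE V W hWV) (CommRingCat.ofHom (evalAtFieldPoint τ.left V hτ))
      ((X ◁ τ).left.appLE W ((X ◁ τ).left ⁻¹ᵁ W) le_rfl)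
      ((Scheme.ΓSpecIso (.of L)).inv ≫
        (fieldPointStr X π).appLE ⊤ ((X ◁ τ).left ⁻¹ᵁ W) le_top) := by
  have H := isPullback_whiskerLeft_mk X T π τ
  have hUY : (X ◁ τ).left ⁻¹ᵁ W = (X ◁ τ).left ⁻¹ᵁ W ⊓ fieldPointStr X π ⁻¹ᵁ ⊤ := by
    simp only [Scheme.Hom.preimage_top, inf_top_eq]
  have hiso := isIso_pushoutSection_of_isAffineOpen H (US := V) (UT := ⊤) (UX := W)
    (UY := (X ◁ τ).left ⁻¹ᵁ W) (top_le_preimage_fieldPoint τ hτ) hWV hUY hV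
    (isAffineOpen_top _) hW
  have hpo := (isIso_pushoutSection_iff H (US := V) (UT := ⊤) (UX := W)
    (UY := (X ◁ τ).left ⁻¹ᵁ W) (top_le_preimage_fieldPoint τ hτ) hWV hUY).mp hiso
  refine hpo.of_iso (Iso.refl _) (Iso.refl _) (Scheme.ΓSpecIso _) (Iso.refl _) (by simp) ?_
    (by simp) ?_
  · rw [Iso.refl_hom, Category.id_comp]
    exact appLE_ΓSpecIso_eq_evalAtFieldPoint τ.left V hτ
  · rw [Iso.refl_hom, Category.comp_id, Iso.hom_inv_id_assoc]

variable (X π)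

/-- The `L`-algebra structure on `Γ(W', 𝒪_{X_L})`: `L ≅ Γ(Spec L, 𝒪) → Γ(X_L, 𝒪) → Γ(W', 𝒪_{X_L})` (an
`abbrev` for `letI`; the structure under which `K(X_L)` is an `L`-algebra through `fibreOverField`). [folklore] -/
abbrev fieldSecAlgebra (W' : (X ⊗ Over.mk π).left.Opens) :
    Algebra L Γ((X ⊗ Over.mk π).left, W') :=
  ((Scheme.ΓSpecIso (.of L)).inv ≫ (fieldPointStr X π).appLE ⊤ W' le_top).hom.toAlgebra

variable (T τ) {π}

/-- `Γ(V, 𝒪_T)` acting on `L` by evaluation at `τ` (`evalAtFieldPoint`; an `abbrev` for `letI`). [folklore] -/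
abbrev evalFieldAlgebra {V : T.left.Opens} (hτ : τ.left (IsLocalRing.closedPoint L) ∈ V) :
    Algebra Γ(T.left, V) L :=
  (evalAtFieldPoint τ.left V hτ).toAlgebra

/-- `Γ(W, 𝒪_{X ×_K T})` acting on `Γ(W_L, 𝒪_{X_L})` by pull-back along `X_L → X ×_K T`. [folklore] -/
abbrev whiskerAlgebra (W : (X ⊗ T).left.Opens) :
    Algebra Γ((X ⊗ T).left, W) Γ((X ⊗ Over.mk π).left, (X ◁ τ).left ⁻¹ᵁ W) :=
  ((X ◁ τ).left.appLE W ((X ◁ τ).left ⁻¹ᵁ W) le_rfl).hom.toAlgebra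

/-- `Γ(V, 𝒪_T)` acting on `Γ(W_L, 𝒪_{X_L})` through `Γ(W, 𝒪)`. [folklore] -/
abbrev baseWhiskerAlgebra {V : T.left.Opens} {W : (X ⊗ T).left.Opens}
    (hWV : W ≤ (snd X T).left ⁻¹ᵁ V) :
    Algebra Γ(T.left, V) Γ((X ⊗ Over.mk π).left, (X ◁ τ).left ⁻¹ᵁ W) :=
  ((((X ◁ τ).left.appLE W ((X ◁ τ).left ⁻¹ᵁ W) le_rfl).hom.comp
    ((snd X T).left.appLE V W hWV).hom).toAlgebra)

variable {X T τ}

/-- `Γ(V, 𝒪_T) → Γ(W, 𝒪) → Γ(W_L, 𝒪)` is a scalar tower (by definition). [folklore] -/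
theorem isScalarTower_prSec_whisker {V : T.left.Opens} {W : (X ⊗ T).left.Opens}
    (hWV : W ≤ (snd X T).left ⁻¹ᵁ V) :
    letI := prSecAlgebra X T hWV
    letI := whiskerAlgebra X T τ W
    letI := baseWhiskerAlgebra X T τ hWV
    IsScalarTower Γ(T.left, V) Γ((X ⊗ T).left, W)
      Γ((X ⊗ Over.mk π).left, (X ◁ τ).left ⁻¹ᵁ W) :=
  letI := prSecAlgebra X T hWV
  letI := whiskerAlgebra X T τ W
  letI := baseWhiskerAlgebra X T τ hWV
  IsScalarTower.of_algebraMap_eq fun _ => rfl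

set_option backward.isDefEq.respectTransparency false in
/-- `Γ(V, 𝒪_T) → L → Γ(W_L, 𝒪)` is a scalar tower: `pr_T^♯(a)|_W` pulls back to the constant `a(τ)`
(commutativity of the base-change square on sections). [folklore] -/
theorem isScalarTower_eval_whisker {V : T.left.Opens} (hτ : τ.left (IsLocalRing.closedPoint L) ∈ V)
    {W : (X ⊗ T).left.Opens} (hWV : W ≤ (snd X T).left ⁻¹ᵁ V) (hV : IsAffineOpen V)
    (hW : IsAffineOpen W) :
    letI := evalFieldAlgebra T τ hτ
    letI := fieldSecAlgebra X π ((X ◁ τ).left ⁻¹ᵁ W)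
    letI := baseWhiskerAlgebra X T τ hWV
    IsScalarTower Γ(T.left, V) L Γ((X ⊗ Over.mk π).left, (X ◁ τ).left ⁻¹ᵁ W) :=
  letI := evalFieldAlgebra T τ hτ
  letI := fieldSecAlgebra X π ((X ◁ τ).left ⁻¹ᵁ W)
  letI := baseWhiskerAlgebra X T τ hWV
  IsScalarTower.of_algebraMap_eq fun a => by
    have h := congr_arg (fun φ => φ.hom a) (isPushout_sections_fieldPoint hτ hWV hV hW).w
    exact h

set_option backward.isDefEq.respectTransparency false in
/-- **`Γ(W_L, 𝒪_{X_L}) = L ⊗_{Γ(V, 𝒪_T)} Γ(W, 𝒪)` as algebras** (`Algebra.IsPushout`), `W`, `V` affine: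
the algebraic form of `isPushout_sections_fieldPoint`. [cite: GortzWedhorn2023, Prop. 22.90, proof (p. 388)] -/
theorem algebraIsPushout_fieldPoint {V : T.left.Opens} (hτ : τ.left (IsLocalRing.closedPoint L) ∈ V)
    {W : (X ⊗ T).left.Opens} (hWV : W ≤ (snd X T).left ⁻¹ᵁ V) (hV : IsAffineOpen V)
    (hW : IsAffineOpen W) :
    letI := evalFieldAlgebra T τ hτ
    letI := prSecAlgebra X T hWV
    letI := fieldSecAlgebra X π ((X ◁ τ).left ⁻¹ᵁ W)
    letI := whiskerAlgebra X T τ W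
    letI := baseWhiskerAlgebra X T τ hWV
    haveI := isScalarTower_prSec_whisker (τ := τ) hWV
    haveI := isScalarTower_eval_whisker hτ hWV hV hW
    Algebra.IsPushout Γ(T.left, V) L Γ((X ⊗ T).left, W)
      Γ((X ⊗ Over.mk π).left, (X ◁ τ).left ⁻¹ᵁ W) := by
  letI := evalFieldAlgebra T τ hτ
  letI := prSecAlgebra X T hWV
  letI := fieldSecAlgebra X π ((X ◁ τ).left ⁻¹ᵁ W)
  letI := whiskerAlgebra X T τ W
  letI := baseWhiskerAlgebra X T τ hWV
  haveI := isScalarTower_prSec_whisker (τ := τ) hWV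
  haveI := isScalarTower_eval_whisker hτ hWV hV hW
  haveI hpo : Algebra.IsPushout Γ(T.left, V) Γ((X ⊗ T).left, W) L
      Γ((X ⊗ Over.mk π).left, (X ◁ τ).left ⁻¹ᵁ W) :=
    CommRingCat.isPushout_iff_isPushout.mp (isPushout_sections_fieldPoint hτ hWV hV hW)
  exact hpo.symm

/-- **Affine base change of sections to `X_L`**: the `L`-algebra isomorphism
`L ⊗_{Γ(V, 𝒪_T)} Γ(W, 𝒪_{X ×_K T}) ⥲ Γ(W_L, 𝒪_{X_L})` (`W ⊆ pr_T⁻¹V` affine, `V ∋ τ(*)` affine; `Γ(V, 𝒪_T)`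
acts on `L` by evaluation at `τ`, on `Γ(W, 𝒪)` through `pr_T`). [cite: GortzWedhorn2023, Prop. 22.90, proof (p. 388)] -/
def fieldPointSectionsEquiv {V : T.left.Opens} (hτ : τ.left (IsLocalRing.closedPoint L) ∈ V)
    {W : (X ⊗ T).left.Opens} (hWV : W ≤ (snd X T).left ⁻¹ᵁ V) (hV : IsAffineOpen V)
    (hW : IsAffineOpen W) :
    letI := evalFieldAlgebra T τ hτ
    letI := prSecAlgebra X T hWV
    letI := fieldSecAlgebra X π ((X ◁ τ).left ⁻¹ᵁ W)
    L ⊗[Γ(T.left, V)] Γ((X ⊗ T).left, W) ≃ₐ[L] Γ((X ⊗ Over.mk π).left, (X ◁ τ).left ⁻¹ᵁ W) :=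
  letI := evalFieldAlgebra T τ hτ
  letI := prSecAlgebra X T hWV
  letI := fieldSecAlgebra X π ((X ◁ τ).left ⁻¹ᵁ W)
  letI := whiskerAlgebra X T τ W
  letI := baseWhiskerAlgebra X T τ hWV
  haveI := isScalarTower_prSec_whisker (τ := τ) hWV
  haveI := isScalarTower_eval_whisker hτ hWV hV hW
  haveI : Algebra.IsPushout Γ(T.left, V) L Γ((X ⊗ T).left, W)
      Γ((X ⊗ Over.mk π).left, (X ◁ τ).left ⁻¹ᵁ W) := algebraIsPushout_fieldPoint hτ hWV hV hW
  Algebra.IsPushout.equiv Γ(T.left, V) L Γ((X ⊗ T).left, W)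
    Γ((X ⊗ Over.mk π).left, (X ◁ τ).left ⁻¹ᵁ W)

/-- **The base-change isomorphism on pure tensors**: `c ⊗ r ↦ c · (r|_{W_L})`. [folklore] -/
theorem fieldPointSectionsEquiv_tmul {V : T.left.Opens}
    (hτ : τ.left (IsLocalRing.closedPoint L) ∈ V) {W : (X ⊗ T).left.Opens}
    (hWV : W ≤ (snd X T).left ⁻¹ᵁ V) (hV : IsAffineOpen V) (hW : IsAffineOpen W) (c : L)
    (r : Γ((X ⊗ T).left, W)) :
    letI := evalFieldAlgebra T τ hτ
    letI := prSecAlgebra X T hWV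
    letI := fieldSecAlgebra X π ((X ◁ τ).left ⁻¹ᵁ W)
    fieldPointSectionsEquiv hτ hWV hV hW (c ⊗ₜ r) =
      algebraMap L _ c * (X ◁ τ).left.appLE W ((X ◁ τ).left ⁻¹ᵁ W) le_rfl r := by
  letI := evalFieldAlgebra T τ hτ
  letI := prSecAlgebra X T hWV
  letI := fieldSecAlgebra X π ((X ◁ τ).left ⁻¹ᵁ W)
  letI := whiskerAlgebra X T τ W
  letI := baseWhiskerAlgebra X T τ hWV
  haveI := isScalarTower_prSec_whisker (τ := τ) hWV
  haveI := isScalarTower_eval_whisker hτ hWV hV hW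
  haveI : Algebra.IsPushout Γ(T.left, V) L Γ((X ⊗ T).left, W)
      Γ((X ⊗ Over.mk π).left, (X ◁ τ).left ⁻¹ᵁ W) := algebraIsPushout_fieldPoint hτ hWV hV hW
  exact Algebra.IsPushout.equiv_tmul Γ(T.left, V) L Γ((X ⊗ T).left, W)
    Γ((X ⊗ Over.mk π).left, (X ◁ τ).left ⁻¹ᵁ W) c r

end Square

/-! ### Base change of `Γ(W, 𝒪(D))` to a field-valued point -/

namespace CartierDivisor

section FieldPointSections

variable {K : Type u} [Field K] {X T : SchemeOver K} {L : Type u} [Field L]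
  {π : Spec (.of L) ⟶ Spec (.of K)} {τ : Over.mk π ⟶ T} [IsIntegral (X ⊗ T).left]
  [IsIntegral (X ⊗ Over.mk π).left] {V : T.left.Opens}
  (hτ : τ.left (IsLocalRing.closedPoint L) ∈ V) {W : (X ⊗ T).left.Opens}
  (hWV : W ≤ (snd X T).left ⁻¹ᵁ V) (D : CartierDivisor (X ⊗ T).left)
  (hVξ : genericPoint (X ⊗ T).left ∈ (snd X T).left ⁻¹ᵁ V)

/-- `L → Γ(W', 𝒪_{X_L})` (`fieldSecAlgebra`) followed by "rational function of a section" is the structure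
map `L → K(X_L)` of the `L`-scheme `X_L` (`fibreOverField`). [folklore] -/
theorem ofSection_fieldSecAlgebra_algebraMap (X : SchemeOver K) (π : Spec (.of L) ⟶ Spec (.of K))
    [IsIntegral (X ⊗ Over.mk π).left] {W' : (X ⊗ Over.mk π).left.Opens}
    (hξ : genericPoint (X ⊗ Over.mk π).left ∈ W') (c : L) :
    letI := fieldSecAlgebra X π W'
    letI := fibreOverField X π
    ofSection hξ (algebraMap L Γ((X ⊗ Over.mk π).left, W') c) =
      algebraMap L (X ⊗ Over.mk π).left.functionField c := by
  letI := fibreOverField X π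
  change ofSection hξ (((Scheme.ΓSpecIso (.of L)).inv ≫
      (fieldPointStr X π).appLE ⊤ W' le_top) c) =
    (X ⊗ Over.mk π).left.presheaf.germ ⊤ (genericPoint _) trivial
      ((fieldPointStr X π).appTop ((Scheme.ΓSpecIso (.of L)).inv c))
  simp only [Scheme.Hom.appLE]
  exact ofSection_map (homOfLE le_top) hξ _

/-- **Sections of `𝒪(D)` over an affine `W ⊆ X ×_K T`, base-changed to a field-valued point `τ`, are
the sections of `𝒪_{X_L}(D_τ)` over `W_L`.** For `V ∋ τ(*)` affine, `W ⊆ pr_T⁻¹V ∩ U_c` affine with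
`y_L = (X ◁ τ)(η_{X_L}) ∈ W`, the `L`-linear isomorphism `L ⊗_{Γ(V, 𝒪_T)} Γ(W, 𝒪(D)) ≅ Γ(W_L, 𝒪_{X_L}(D_τ))`
(`D_τ = classPullback D (X ◁ τ).left`): trivialisation `Γ(W, 𝒪(D)) = f_c⁻¹ Γ(W, 𝒪)` (Görtz–Wedhorn I,
(11.9)), affine base change `L ⊗ Γ(W, 𝒪) ≅ Γ(W_L, 𝒪_{X_L})` (`fieldPointSectionsEquiv`), trivialisation
`Γ(W_L, 𝒪_{X_L}(D_τ)) = ι^♯(f_c/f_{i₀})⁻¹ Γ(W_L, 𝒪_{X_L})` (Görtz–Wedhorn I, (11.16): `f^*𝒪(D) ≅ 𝒪(f^*D)`);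
on elements `c ⊗ s ↦ c · ι^♯(f_{i₀} s)` (`coe_fieldPointSectionsOnEquiv_tmul`).
[cite: GortzWedhorn2020, Section (11.16) (p. 392); base change as in GortzWedhorn2023, Prop. 22.90, proof (p. 388)] -/
def fieldPointSectionsOnEquiv (hV : IsAffineOpen V) (hW : IsAffineOpen W) {c : D.ι}
    (hWc : W ≤ D.U c) (hy : (X ◁ τ).left (genericPoint _) ∈ W) :
    letI := CartierDivisor.baseAlgebra (snd X T).left V hVξ
    letI := evalFieldAlgebra T τ hτ
    letI := fibreOverField X π
    L ⊗[Γ(T.left, V)] D.sectionsOn W (fun a _ hx =>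
        isRegularAt_baseAlgebra_algebraMap (snd X T).left V hVξ a (hWV hx)) ≃ₗ[L]
      (D.classPullback (X ◁ τ).left).sectionsOn (A := L) ((X ◁ τ).left ⁻¹ᵁ W)
        (fun c _ _ => isRegularAt_algebraMap _ c) := by
  letI := CartierDivisor.baseAlgebra (snd X T).left V hVξ
  letI := evalFieldAlgebra T τ hτ
  letI := fibreOverField X π
  letI := prSecAlgebra X T hWV
  letI := fieldSecAlgebra X π ((X ◁ τ).left ⁻¹ᵁ W)
  have hξW : genericPoint (X ⊗ T).left ∈ W := genericPoint_mem_of_mem hy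
  have hξ' : genericPoint (X ⊗ Over.mk π).left ∈ (X ◁ τ).left ⁻¹ᵁ W := hy
  refine (LinearEquiv.baseChange Γ(T.left, V) L _ _ (D.sectionsOnEquiv hξW hWc
    (ofSection_secAlgebra_algebraMap (snd X T).left V hVξ W hWV hξW) _).symm).trans
    ((fieldPointSectionsEquiv hτ hWV hV hW).toLinearEquiv.trans
      ((D.classPullback (X ◁ τ).left).sectionsOnEquiv hξ'
        (i := D.classPullbackChart (X ◁ τ).left (hWc hy))
        (fun x hx => ⟨hWc hx, trivial⟩) (ofSection_fieldSecAlgebra_algebraMap X π hξ') _))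

/-- **`fieldPointSectionsOnEquiv (c ⊗ s) = c · ι^♯(f_{i₀} s)`** (`CartierDivisor.fibreFn`, `ι = (X ◁ τ).left`):
the isomorphism is restriction of rational sections to `X_L`, independent of `W` and `c`. [folklore] -/
theorem coe_fieldPointSectionsOnEquiv_tmul (hV : IsAffineOpen V) (hW : IsAffineOpen W) {c : D.ι}
    (hWc : W ≤ D.U c) (hy : (X ◁ τ).left (genericPoint _) ∈ W) (c' : L)
    (s : letI := CartierDivisor.baseAlgebra (snd X T).left V hVξ
      D.sectionsOn W (fun a _ hx =>
        isRegularAt_baseAlgebra_algebraMap (snd X T).left V hVξ a (hWV hx))) :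
    letI := CartierDivisor.baseAlgebra (snd X T).left V hVξ
    letI := evalFieldAlgebra T τ hτ
    letI := fibreOverField X π
    ((D.fieldPointSectionsOnEquiv hτ hWV hVξ hV hW hWc hy (c' ⊗ₜ s) :
        (D.classPullback (X ◁ τ).left).sectionsOn (A := L) ((X ◁ τ).left ⁻¹ᵁ W)
          (fun c _ _ => isRegularAt_algebraMap _ c)) :
      (X ⊗ Over.mk π).left.functionField) = c' • D.fibreFn (X ◁ τ).left s := by
  letI := CartierDivisor.baseAlgebra (snd X T).left V hVξ
  letI := evalFieldAlgebra T τ hτ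
  letI := fibreOverField X π
  letI := prSecAlgebra X T hWV
  letI := fieldSecAlgebra X π ((X ◁ τ).left ⁻¹ᵁ W)
  have hξW : genericPoint (X ⊗ T).left ∈ W := genericPoint_mem_of_mem hy
  have hξ' : genericPoint (X ⊗ Over.mk π).left ∈ (X ◁ τ).left ⁻¹ᵁ W := hy
  set e₀ := D.sectionsOnEquiv hξW hWc
    (ofSection_secAlgebra_algebraMap (snd X T).left V hVξ W hWV hξW)
    (fun a _ hx => isRegularAt_baseAlgebra_algebraMap (snd X T).left V hVξ a (hWV hx)) with he₀
  obtain ⟨g, rfl⟩ := e₀.surjective s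
  simp only [fieldPointSectionsOnEquiv, LinearEquiv.trans_apply]
  rw [← he₀, LinearEquiv.baseChange_tmul, LinearEquiv.symm_apply_apply, AlgEquiv.toLinearEquiv_apply,
    fieldPointSectionsEquiv_tmul, coe_sectionsOnEquiv, he₀, coe_sectionsOnEquiv, classPullback_f,
    Algebra.smul_def]
  have hmul : ofSection hξ' (algebraMap L _ c' *
      (X ◁ τ).left.appLE W ((X ◁ τ).left ⁻¹ᵁ W) le_rfl g) =
      algebraMap L (X ⊗ Over.mk π).left.functionField c' *
        pullbackFn (X ◁ τ).left (ofSection hξW g) := by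
    rw [← ofSection_fieldSecAlgebra_algebraMap X π hξ' c',
      ← ofSection_appLE (X ◁ τ).left (le_refl _) hξ' g]
    exact map_mul _ _ _
  rw [hmul, mul_assoc]
  congr 1
  -- the rational identity `ι^♯(g) / ι^♯(f_c/f_{i₀}) = ι^♯(f_{i₀} (g / f_c))`
  have hu := D.isUnitAt_f_div_f_chartAt (X ◁ τ).left (hWc hy)
  have hg : IsRegularAt ((X ◁ τ).left (genericPoint _)) (ofSection hξW g) :=
    isRegularAt_ofSection hy g
  dsimp only [classPullbackChart]
  rw [CartierDivisor.fibreFn, ← pullbackFn_inv _ hu, ← pullbackFn_mul _ hg hu.inv.isRegularAt]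
  congr 1
  field_simp [D.f_ne_zero c, D.f_ne_zero (D.chartAt ((X ◁ τ).left (genericPoint _)))]

/-- If `y_L = (X ◁ τ)(η_{X_L}) ∉ W` (`W_L = ∅`) then `L ⊗_{Γ(V, 𝒪_T)} Γ(W, 𝒪(D)) = 0`. [folklore] -/
theorem subsingleton_tensorProduct_sectionsOn_fieldPoint (hV : IsAffineOpen V) (hW : IsAffineOpen W)
    {c : D.ι} (hWc : W ≤ D.U c) (hξW : genericPoint (X ⊗ T).left ∈ W)
    (hy : (X ◁ τ).left (genericPoint _) ∉ W) :
    letI := CartierDivisor.baseAlgebra (snd X T).left V hVξ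
    letI := evalFieldAlgebra T τ hτ
    Subsingleton (L ⊗[Γ(T.left, V)] D.sectionsOn W (fun a _ hx =>
        isRegularAt_baseAlgebra_algebraMap (snd X T).left V hVξ a (hWV hx))) := by
  letI := CartierDivisor.baseAlgebra (snd X T).left V hVξ
  letI := evalFieldAlgebra T τ hτ
  letI := prSecAlgebra X T hWV
  letI := fieldSecAlgebra X π ((X ◁ τ).left ⁻¹ᵁ W)
  have hbot : (X ◁ τ).left ⁻¹ᵁ W = ⊥ := preimage_eq_bot_of_notMem _ hy
  haveI : Subsingleton Γ((X ⊗ Over.mk π).left, (X ◁ τ).left ⁻¹ᵁ W) :=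
    CommRingCat.subsingleton_of_isTerminal
      ((X ⊗ Over.mk π).left.sheaf.isTerminalOfEqEmpty (by rw [hbot]))
  exact ((LinearEquiv.baseChange Γ(T.left, V) L _ _ (D.sectionsOnEquiv hξW
    hWc (ofSection_secAlgebra_algebraMap (snd X T).left V hVξ W hWV hξW) _).symm).trans
    (fieldPointSectionsEquiv hτ hWV hV hW).toLinearEquiv).toEquiv.subsingleton

end FieldPointSections

end CartierDivisor

end Literature.AlgebraicGeometry.Motives

end
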